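import Summits.MatrixMultiplication.OmegaCensus.STPPVosperCoverSearchSound

/-!
# ω-census (abelian STPP census): the two-stage cover search WITH THE DEF. 5.1 WORDS among the other blocks — checker and stage-2 soundness (kernel)

HONEST FRAMING (pub-omega census; verbatim): lottery ticket; floor = certified bounds/negative ranges.
Census STRUCTURE (seat pub-omega-stpp-2 gen 25, 2026-08-28), family (b2).  The WORDS LAYER on top of `coverSearch` (`STPPVosperCoverSearch.lean`): an exact
cover of the rigid sets `Y°`, `Z°` by the other blocks' difference sets is only an obstruction-free CANDIDATE; the STPP word `z_k = x_i + y_j ⇒ i = j = k`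
(CKSU Def. 5.1, `z ∈ C_k − A_k`, `x ∈ B_i − A_i`, `y ∈ C_j − B_j`) also constrains the other blocks AMONG THEMSELVES.  All difference sets are invariant under the
per-block translations of the normal form, so nothing is lost by testing the words on the search's value lists (`Zv = C − A`, `X̃v = A − B`, `Yv = C − B` of
each placed block, full point lists `YL`, `ZL`):

* `blockWordsOK` (one block): for `a ≠ a′`:  `(Zv(c,a) + X̃v(a′,b)) mod p ∉ YL`  (word with `s ≠ s′` in the same block);  for `b ≠ b′`:
  `(Zv(c,a) + (b − b′)) mod p ∉ ZL`  (word with `t ≠ t′`);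
* `crossWordsOK` (the block against every completed block `k′ ≠ k`):  `(Zv_k + X̃v_{k′}) mod p ∉ YL` and `(Zv_{k′} + X̃v_k) mod p ∉ YL`  (word with the two
  `A`-letters in different blocks).
`coverSearchW p YL ZL sizes` = `coverSearch` with these tests at every `A`-choice of stage 2 (stage 1 unchanged).  §3: stage-2 soundness `coverZW_complete`;
stage 1 and the extraction from an STPP family: `STPPVosperCoverSearchWSound.lean`, `STPPVosperCoverExtractW.lean`.  Python mirror with the same enumeration and a
step counter: HOME `pub-omega-stpp-2-g25/code/pilot/cover_wfull.py` (K5 `{(1,1,2),(3,5,2)²}` @61: all 60 ratios fail, ≈ 5·10⁵ steps for the table survivors).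
Nothing here is progress on `ω`.

References: H. Cohn, R. Kleinberg, B. Szegedy, C. Umans, FOCS 2005 (arXiv:math/0511460), Def. 5.1.
-/

open Finset
open scoped Pointwise

namespace Summit.MatrixMultiplication.OmegaCensus.CubeNB

open Literature.Computability.AlgebraicComplexity
open Literature.Combinatorics.Additive
open Summit.MatrixMultiplication.OmegaCensus.STPPKneser

/-! ## §1 The checker -/

section Search

/-- Words of ONE block on value lists (`B` including `0`): `a ≠ a′ ⇒ ((c−a) + (a′−b)) mod p ∉ YL` and `b ≠ b′ ⇒ ((c−a) + (b−b′)) mod p ∉ ZL`. [folklore] -/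
def blockWordsOK (p : ℕ) (YL ZL C B A : List ℕ) : Bool :=
  C.all fun c => A.all fun a =>
    (A.all fun a' => (a == a') || B.all fun b => !(decide (((c + p - a) % p + (a' + p - b) % p) % p ∈ YL))) &&
    (B.all fun b => B.all fun b' => (b == b') || !(decide (((c + p - a) % p + (b + p - b') % p) % p ∈ ZL)))

/-- Words of a block (Z-list `dCA`, X̃-list `dAB`) against the completed blocks `done` (entries `(Zv, X̃v)`): `(z + x′) mod p ∉ YL` and `(z′ + x) mod p ∉ YL`.
[folklore] -/
def crossWordsOK (p : ℕ) (YL dCA dAB : List ℕ) (done : List (List ℕ × List ℕ)) : Bool :=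
  done.all fun e => (dCA.all fun z => e.2.all fun x => !(decide ((z + x) % p ∈ YL))) && (e.1.all fun z => dAB.all fun x => !(decide ((z + x) % p ∈ YL)))

/-- Stage 2 with words: as `coverZ`, testing `blockWordsOK` and `crossWordsOK` at every `A`-choice and recording `(C − A, A − B)` of completed blocks.
[folklore] -/
def coverZW (p : ℕ) (YL ZL : List ℕ) : List ℕ → List (ℕ × List ℕ × List ℕ) → List (List ℕ × List ℕ) → Bool
  | RZ, [], _ => RZ.isEmpty
  | RZ, (a, C, B') :: rest, done =>
    ((shiftCands p C RZ).sublistsLen a).any fun A =>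
      (diffList p C A).Nodup && (diffList p A (0 :: B')).Nodup && blockWordsOK p YL ZL C (0 :: B') A &&
        crossWordsOK p YL (diffList p C A) (diffList p A (0 :: B')) done &&
        coverZW p YL ZL (RZ.filter fun t => !(decide (t ∈ diffList p C A))) rest ((diffList p C A, diffList p A (0 :: B')) :: done)

/-- Stage 1 (unchanged search, the full lists threaded through for the words of stage 2). [folklore] -/
def coverYW (p : ℕ) (YL ZL RZ : List ℕ) : List ℕ → List (ℕ × ℕ × ℕ) → List (ℕ × List ℕ × List ℕ) → Bool
  | RY, [], chosen => RY.isEmpty && coverZW p YL ZL RZ chosen []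
  | RY, (a, b, c) :: rest, chosen =>
    (yCands p RY b c).any fun CB =>
      decide (a ≤ (shiftCands p CB.1 RZ).length) &&
        coverYW p YL ZL RZ (RY.filter fun y => !(decide (y ∈ diffList p CB.1 (0 :: CB.2)))) rest ((a, CB.1, CB.2) :: chosen)

/-- **The two-stage exact-cover search with words** on de-duplicated point lists. [folklore] -/
def coverSearchW (p : ℕ) (YL ZL : List ℕ) (sizes : List (ℕ × ℕ × ℕ)) : Bool :=
  coverYW p YL.dedup ZL.dedup ZL.dedup YL.dedup sizes []

end Search

/-! ## §2 The word tests hold for genuine lists -/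

section Facts

variable {p : ℕ}

/-- `blockWordsOK` from element-wise word facts. [folklore] -/
theorem blockWordsOK_of {YL ZL C B A : List ℕ}
    (hY : ∀ c ∈ C, ∀ a ∈ A, ∀ a' ∈ A, ∀ b ∈ B, a ≠ a' → ((c + p - a) % p + (a' + p - b) % p) % p ∉ YL)
    (hZ : ∀ c ∈ C, ∀ a ∈ A, ∀ b ∈ B, ∀ b' ∈ B, b ≠ b' → ((c + p - a) % p + (b + p - b') % p) % p ∉ ZL) :
    blockWordsOK p YL ZL C B A = true := by
  rw [blockWordsOK, List.all_eq_true]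
  intro c hc
  rw [List.all_eq_true]
  intro a ha
  rw [Bool.and_eq_true, List.all_eq_true, List.all_eq_true]
  constructor
  · intro a' ha'
    rw [Bool.or_eq_true, List.all_eq_true]
    by_cases h : a = a'
    · exact Or.inl (by rw [h, beq_self_eq_true])
    · exact Or.inr fun b hb => by rw [Bool.not_eq_true', decide_eq_false_iff_not]; exact hY c hc a ha a' ha' b hb h
  · intro b hb
    rw [List.all_eq_true]
    intro b' hb'
    rw [Bool.or_eq_true]
    by_cases h : b = b'
    · exact Or.inl (by rw [h, beq_self_eq_true])
    · exact Or.inr (by rw [Bool.not_eq_true', decide_eq_false_iff_not]; exact hZ c hc a ha b hb b' hb' h)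

/-- `crossWordsOK` from element-wise word facts. [folklore] -/
theorem crossWordsOK_of {YL dCA dAB : List ℕ} {done : List (List ℕ × List ℕ)}
    (h1 : ∀ e ∈ done, ∀ z ∈ dCA, ∀ x ∈ e.2, (z + x) % p ∉ YL) (h2 : ∀ e ∈ done, ∀ z ∈ e.1, ∀ x ∈ dAB, (z + x) % p ∉ YL) :
    crossWordsOK p YL dCA dAB done = true := by
  rw [crossWordsOK, List.all_eq_true]
  intro e he
  rw [Bool.and_eq_true, List.all_eq_true, List.all_eq_true]
  constructor
  · intro z hz
    rw [List.all_eq_true]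
    intro x hx
    rw [Bool.not_eq_true', decide_eq_false_iff_not]
    exact h1 e he z hz x hx
  · intro z hz
    rw [List.all_eq_true]
    intro x hx
    rw [Bool.not_eq_true', decide_eq_false_iff_not]
    exact h2 e he z hz x hx

end Facts

/-! ## §3 Soundness of stage 2 with words -/

section Sound

variable {ι : Type*} {p : ℕ} (good : ι → Prop) (sz : ι → ℕ × ℕ × ℕ) (Av Bv Cv : ι → Finset ℕ) (YL ZL : List ℕ)

/-- **Soundness of stage 2 with words.**  As `coverZ_complete`, with the word facts: for good `k, k′` and `c ∈ Cv k`, `a ∈ Av k`, `a′ ∈ Av k′`, `b ∈ Bv k′`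
with `k ≠ k′ ∨ a ≠ a′`: `((c−a) + (a′−b)) mod p ∉ YL`; for good `k`, `b ≠ b′ ∈ Bv k`: `((c−a) + (b−b′)) mod p ∉ ZL`.  The completed-block list `doneW` must consist of
the `(C − A, A − B)` value lists of good blocks NOT among the pending ones. [folklore] -/
theorem coverZW_complete (hszA : ∀ k, good k → #(Av k) = (sz k).1)
    (hAp : ∀ k, ∀ x ∈ Av k, x < p) (hCp : ∀ k, ∀ x ∈ Cv k, x < p) (hCne : ∀ k, good k → (Cv k).Nonempty)
    (hinjZ : ∀ k, good k → ∀ c ∈ Cv k, ∀ c' ∈ Cv k, ∀ x ∈ Av k, ∀ x' ∈ Av k, (c + p - x) % p = (c' + p - x') % p → c = c' ∧ x = x')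
    (hinjX : ∀ k, good k → ∀ c ∈ Av k, ∀ c' ∈ Av k, ∀ x ∈ Bv k, ∀ x' ∈ Bv k, (c + p - x) % p = (c' + p - x') % p → c = c' ∧ x = x')
    (hWY : ∀ k, good k → ∀ k', good k' → ∀ c ∈ Cv k, ∀ a ∈ Av k, ∀ a' ∈ Av k', ∀ b ∈ Bv k', (k ≠ k' ∨ a ≠ a') →
      ((c + p - a) % p + (a' + p - b) % p) % p ∉ YL)
    (hWZ : ∀ k, good k → ∀ c ∈ Cv k, ∀ a ∈ Av k, ∀ b ∈ Bv k, ∀ b' ∈ Bv k, b ≠ b' → ((c + p - a) % p + (b + p - b') % p) % p ∉ ZL) :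
    ∀ (done : List (ι × List ℕ × List ℕ)), (done.map Prod.fst).Nodup →
      (∀ e ∈ done, (good e.1 ∧ e.2.1.Nodup ∧ (∀ x, x ∈ e.2.1 ↔ x ∈ Cv e.1) ∧ (0 :: e.2.2).Nodup ∧ (∀ x, x ∈ (0 :: e.2.2) ↔ x ∈ Bv e.1))) →
      ∀ (RZ : List ℕ) (doneW : List (List ℕ × List ℕ)),
      (∀ w ∈ doneW, ∃ k', good k' ∧ k' ∉ done.map Prod.fst ∧ (∀ z, z ∈ w.1 ↔ ∃ c ∈ Cv k', ∃ a ∈ Av k', (c + p - a) % p = z) ∧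
        (∀ x, x ∈ w.2 ↔ ∃ a ∈ Av k', ∃ b ∈ Bv k', (a + p - b) % p = x)) →
      (∀ e ∈ done, ∀ c ∈ Cv e.1, ∀ x ∈ Av e.1, (c + p - x) % p ∈ RZ) →
      (∀ e ∈ done, ∀ e' ∈ done, e.1 ≠ e'.1 → ∀ c ∈ Cv e.1, ∀ x ∈ Av e.1, ∀ c' ∈ Cv e'.1, ∀ x' ∈ Av e'.1,
        (c + p - x) % p ≠ (c' + p - x') % p) →
      (∀ t ∈ RZ, ∃ e ∈ done, ∃ c ∈ Cv e.1, ∃ x ∈ Av e.1, (c + p - x) % p = t) →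
      coverZW p YL ZL RZ (done.map fun e => ((sz e.1).1, e.2.1, e.2.2)) doneW = true := by
  intro done
  induction done with
  | nil =>
    intro _ _ RZ doneW _ _ _ hcov
    cases RZ with
    | nil => rfl
    | cons t _ =>
      exfalso
      obtain ⟨e, he, -⟩ := hcov t (by simp)
      simp at he
  | cons e rest ih =>
    intro hnd hok RZ doneW hdoneW hZ hdisj hcov
    obtain ⟨k, Cl, Bl⟩ := e
    rw [List.map_cons, List.nodup_cons] at hnd
    obtain ⟨hkrest, hndrest⟩ := hnd
    obtain ⟨hgk, hClnd, hClmem, hB0nd, hB0l⟩ := hok (k, Cl, Bl) (by simp)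
    have hokrest : ∀ e ∈ rest, (good e.1 ∧ e.2.1.Nodup ∧ (∀ x, x ∈ e.2.1 ↔ x ∈ Cv e.1) ∧ (0 :: e.2.2).Nodup ∧ (∀ x, x ∈ (0 :: e.2.2) ↔ x ∈ Bv e.1)) :=
      fun e' he' => hok e' (by simp [he'])
    obtain ⟨Al, hAlnd, hAlmem, hAlsub, hn2, hn3⟩ := exists_aList_of_block (RZ := RZ) (Av k) (Bv k) (Cv k) hClnd hClmem hB0nd hB0l
      (hAp k) (hCp k) (hCne k hgk) (hZ (k, Cl, Bl) (by simp)) (hinjZ k hgk) (hinjX k hgk)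
    have hca : #(Av k) = (sz k).1 := hszA k hgk
    -- meaning of the two difference lists of this block
    have hZmem : ∀ t, t ∈ diffList p Cl Al ↔ ∃ c ∈ Cv k, ∃ x ∈ Av k, (c + p - x) % p = t := by
      intro t; rw [mem_diffList]
      constructor
      · rintro ⟨c, hc, x, hx, h⟩; exact ⟨c, (hClmem _).1 hc, x, (hAlmem _).1 hx, h⟩
      · rintro ⟨c, hc, x, hx, h⟩; exact ⟨c, (hClmem _).2 hc, x, (hAlmem _).2 hx, h⟩
    have hXmem : ∀ t, t ∈ diffList p Al (0 :: Bl) ↔ ∃ a ∈ Av k, ∃ b ∈ Bv k, (a + p - b) % p = t := by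
      intro t; rw [mem_diffList]
      constructor
      · rintro ⟨a, ha, b, hb, h⟩; exact ⟨a, (hAlmem _).1 ha, b, (hB0l _).1 hb, h⟩
      · rintro ⟨a, ha, b, hb, h⟩; exact ⟨a, (hAlmem _).2 ha, b, (hB0l _).2 hb, h⟩
    have hne : ∀ e' ∈ rest, k ≠ e'.1 := by
      intro e' he' heq
      exact hkrest (heq ▸ List.mem_map.2 ⟨e', he', rfl⟩)
    -- the word tests pass for the genuine lists
    have hbw : blockWordsOK p YL ZL Cl (0 :: Bl) Al = true :=
      blockWordsOK_of (fun c hc a ha a' ha' b hb hne' => hWY k hgk k hgk c ((hClmem _).1 hc) a ((hAlmem _).1 ha) a' ((hAlmem _).1 ha') b ((hB0l _).1 hb)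
          (Or.inr hne'))
        (fun c hc a ha b hb b' hb' hne' => hWZ k hgk c ((hClmem _).1 hc) a ((hAlmem _).1 ha) b ((hB0l _).1 hb) b' ((hB0l _).1 hb') hne')
    have hcw : crossWordsOK p YL (diffList p Cl Al) (diffList p Al (0 :: Bl)) doneW = true := by
      refine crossWordsOK_of (fun w hw z hz x hx => ?_) (fun w hw z hz x hx => ?_)
      · obtain ⟨k', hgk', hk'not, hw1, hw2⟩ := hdoneW w hw
        obtain ⟨c, hc, a, ha, rfl⟩ := (hZmem z).1 hz
        obtain ⟨a', ha', b, hb, rfl⟩ := (hw2 x).1 hx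
        exact hWY k hgk k' hgk' c hc a ha a' ha' b hb (Or.inl fun heq => hk'not (by rw [← heq]; simp))
      · obtain ⟨k', hgk', hk'not, hw1, hw2⟩ := hdoneW w hw
        obtain ⟨c, hc, a, ha, rfl⟩ := (hw1 z).1 hz
        obtain ⟨a', ha', b, hb, rfl⟩ := (hXmem x).1 hx
        exact hWY k' hgk' k hgk c hc a ha a' ha' b hb (Or.inl fun heq => hk'not (by rw [heq]; simp))
    rw [List.map_cons, coverZW, List.any_eq_true]
    refine ⟨Al, by rw [← hca]; exact hAlsub, ?_⟩
    rw [Bool.and_eq_true, Bool.and_eq_true, Bool.and_eq_true, Bool.and_eq_true, decide_eq_true_eq, decide_eq_true_eq]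
    refine ⟨⟨⟨⟨hn2, hn3⟩, hbw⟩, hcw⟩, ?_⟩
    apply ih hndrest hokrest
    · -- the completed-block list grows by block k
      intro w hw
      rw [List.mem_cons] at hw
      rcases hw with rfl | hw
      · exact ⟨k, hgk, fun hmem => by
          obtain ⟨e', he', hek⟩ := List.mem_map.1 hmem
          exact hne e' he' hek.symm, hZmem, hXmem⟩
      · obtain ⟨k', hgk', hk'not, hw1, hw2⟩ := hdoneW w hw
        exact ⟨k', hgk', fun hmem => hk'not (by rw [List.map_cons]; exact List.mem_cons_of_mem _ hmem), hw1, hw2⟩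
    · intro e' he' c hc x hx
      rw [List.mem_filter]
      refine ⟨hZ e' (by simp [he']) c hc x hx, ?_⟩
      rw [Bool.not_eq_true', decide_eq_false_iff_not]
      intro hmem
      obtain ⟨c₂, hc₂, x₂, hx₂, h₂⟩ := (hZmem _).1 hmem
      exact hdisj (k, Cl, Bl) (by simp) e' (by simp [he']) (hne e' he') c₂ hc₂ x₂ hx₂ c hc x hx h₂
    · intro e₁ he₁ e₂ he₂ hne12
      exact hdisj e₁ (by simp [he₁]) e₂ (by simp [he₂]) hne12
    · intro t ht
      rw [List.mem_filter, Bool.not_eq_true', decide_eq_false_iff_not] at ht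
      obtain ⟨htRZ, htnot⟩ := ht
      obtain ⟨e', he', c, hc, x, hx, h⟩ := hcov t htRZ
      rw [List.mem_cons] at he'
      rcases he' with rfl | he'
      · exact absurd ((hZmem t).2 ⟨c, hc, x, hx, h⟩) htnot
      · exact ⟨e', he', c, hc, x, hx, h⟩

end Sound

end Summit.MatrixMultiplication.OmegaCensus.CubeNB
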